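import Literature.NumberTheory.LFunctions.Zhang2022.RepairDiscSTheta0

/-!
# Zhang (2022), repair rung F-S1R: the K-S2 discrepancy on the printed `ι`-fibre — closed form and
# interval boxes of the ten window integrals

Y. Zhang, *Discrete mean estimates and the Landau–Siegel zero*, arXiv:2211.02515v1 (2022)
[Zhang2022LandauSiegel] — an unrefereed manuscript under adjudication; **nothing here is a claim about
its Theorems 1–2 or about Landau–Siegel zeros.** Annex to the repair cell's closing item [Q2-3] (kernel
discrepancy at `θ₀`), after `RepairDiscSTheta0` (`discS θ₀` as ten window integrals) and
`RepairWindowFormClosedB` (`J•w_closed_of_ne/_of_eq`); the kernel certificate and its consequences are in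
`RepairDiscSFiberCert`.

On the printed structural fibre `thetaIota w₂ w₃ w₄ = (0.504, 0.5, 0.498; 3/2, 5/2, 3/2; w; 1/2)`
(`RepairTheta`; in the class, `RepairAdmissible.admissible_thetaIota`) the discrepancy between the `𝔠₃`
functional of record `frakc3S` (exact bilinear cross term, `RepairFrakc3S`) and the transcribed reduced
`𝔠₃` of (18.1) (`frakc3rT`) is AFFINE in `ῑ₃, ῑ₄` with two `ι`-free constants:

* `discS_thetaIota` — `discS (thetaIota w) = ῑ₄·disc4 + ῑ₃·disc3`, `disc4 = Xw12 − e2coef4`,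
  `disc3 = Xw13 − e2coef3`, where `Xw12 = Xw(0.504,3/2;0.5,5/2)`, `Xw13 = Xw(0.504,3/2;0.498,3/2)` are the
  one-window forms as five window integrals each (`Xw_eq_window_integrals`) and `e2coef4, e2coef3` are the
  `ῑ₄, ῑ₃`-coefficients of `2e₂*` (12.15) (`two_mul_e2starG`); `discS_theta0_fiber` (the printed `ι`);
  `C232S_thetaIota_eq : C232S (thetaIota w) = C232cG w + 2 Re(ῑ₄·disc4 + ῑ₃·disc3)`
  (`RepairFrakc3S.C232S_eq_C232D_add` + `RepairFrakc12Theta.C232D_thetaIota`).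
* Interval boxes (engine `Literature.Analysis.ValidatedNumerics.FixedPointInterval`, scale `2^48`) of the ten
  window integrals at the two printed windows through `RepairBoxPrimitives.expQuadIntBR` (window `(1,2)`:
  frequency `k₂ − k₁ = 1`, length `L₇ = 0.004`) and `Section8Certificate.polyIntB` (window `(1,3)`:
  `k₃ = k₁`, length `L₆ = 0.002`; the `J₅` tail piece has frequency `−k₁`): `mem_J1w12 … mem_J5w13`
  [R. E. Moore, *Interval Analysis* (1966), Thm 3.1].

Closed forms from the cited files + interval arithmetic. No `Prop` facts, no axioms beyond the standard three.
-/

noncomputable section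

open Complex Real ComplexConjugate
open Literature.Analysis.ValidatedNumerics.Numerics

namespace Literature.NumberTheory.LFunctions.Zhang2022

namespace Repair

/-! ### The two `ι`-free constants of the discrepancy on the printed fibre -/

/-- `Xw(ν₁,k₁;ν₂,k₂)` at the printed data `(0.504, 3/2; 0.5, 5/2)` as the five window integrals
(`Xw_eq_window_integrals`). [cite: Zhang2022LandauSiegel, §12 (12.12)–(12.14)] -/
def Xw12 : ℂ := -((8 / π : ℝ) : ℂ) * J1w 0.504 (3/2) 0.5 (5/2)
        + ((88 * π : ℝ) : ℂ) * J2w 0.504 (3/2) 0.5 (5/2)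
        - 24 * I * (J3w 0.504 (3/2) 0.5 (5/2) + J4w 0.504 (3/2) 0.5 (5/2))
        - ((48 * π ^ 2 : ℝ) : ℂ) * I * J5w 0.504 (3/2) 0.5 (5/2)

/-- `Xw(ν₁,k₁;ν₃,k₃)` at the printed data `(0.504, 3/2; 0.498, 3/2)`. [cite: Zhang2022LandauSiegel, §12 (12.12)–(12.14)] -/
def Xw13 : ℂ := -((8 / π : ℝ) : ℂ) * J1w 0.504 (3/2) 0.498 (3/2)
        + ((88 * π : ℝ) : ℂ) * J2w 0.504 (3/2) 0.498 (3/2)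
        - 24 * I * (J3w 0.504 (3/2) 0.498 (3/2) + J4w 0.504 (3/2) 0.498 (3/2))
        - ((48 * π ^ 2 : ℝ) : ℂ) * I * J5w 0.504 (3/2) 0.498 (3/2)

/-- The `ῑ₄`-coefficient of `2e₂*` (12.15): `(4/(0.504π))·(−2·0.008 − 4πi/250²)`. [cite: Zhang2022LandauSiegel, §12 (12.15)] -/
def e2coef4 : ℂ := ((4 / (0.504 * π) : ℝ) : ℂ) * (-(2 * 0.008) - 4 * π * I / 250 ^ 2)

/-- The `ῑ₃`-coefficient of `2e₂*` (12.15): `(4/(0.504π))·(−2·0.002/0.498)`. [cite: Zhang2022LandauSiegel, §12 (12.15)] -/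
def e2coef3 : ℂ := ((4 / (0.504 * π) : ℝ) : ℂ) * (-(2 * 0.002) / 0.498)

/-- `disc4 = Xw(0.504,3/2;0.5,5/2) − e2coef4`: the `ῑ₄`-coefficient of `discS` on the printed fibre. [cite: Zhang2022LandauSiegel, §12 (12.12)–(12.15); §18 (18.1)] -/
def disc4 : ℂ := Xw12 - e2coef4

/-- `disc3 = Xw(0.504,3/2;0.498,3/2) − e2coef3`: the `ῑ₃`-coefficient of `discS` on the printed fibre. [cite: Zhang2022LandauSiegel, §12 (12.12)–(12.15); §18 (18.1)] -/
def disc3 : ℂ := Xw13 - e2coef3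

/-- `2e₂*(ι₃,ι₄) = ῑ₄·e2coef4 + ῑ₃·e2coef3`. [cite: Zhang2022LandauSiegel, §12 (12.15)] -/
theorem two_mul_e2starG (w3 w4 : ℂ) : 2 * e2starG w3 w4 = conj w4 * e2coef4 + conj w3 * e2coef3 := by
  unfold e2starG e2coef4 e2coef3; ring

/-- **The discrepancy on the printed fibre is affine in `ῑ`**: `discS (thetaIota w) = ῑ₄·disc4 + ῑ₃·disc3`.
[cite: Zhang2022LandauSiegel, §12 (12.12)–(12.15); §18 (18.1)] -/
theorem discS_thetaIota (w2 w3 w4 : ℂ) :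
    discS (thetaIota w2 w3 w4) = conj w4 * disc4 + conj w3 * disc3 := by
  rw [discS_eq_window_integrals (admissible_thetaIota w2 w3 w4), e2starT_thetaIota, two_mul_e2starG]
  simp only [thetaIota]
  unfold disc4 disc3 Xw12 Xw13
  ring

/-- At the printed `ι` of (2.26): `discS θ₀ = ῑ₄·disc4 + ῑ₃·disc3`. [cite: Zhang2022LandauSiegel, §2 (2.26); §18 (18.1)] -/
theorem discS_theta0_fiber : discS theta0 = conj iota4 * disc4 + conj iota3 * disc3 := by
  rw [← thetaIota_iota, discS_thetaIota]

/-- **`C₂₃₂ˢ` on the printed fibre**: `C232S (thetaIota w) = C232cG w + 2 Re(ῑ₄·disc4 + ῑ₃·disc3)`.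
[cite: Zhang2022LandauSiegel, §2 (2.32); §18] -/
theorem C232S_thetaIota_eq (w2 w3 w4 : ℂ) :
    C232S (thetaIota w2 w3 w4) = C232cG w2 w3 w4 + 2 * (conj w4 * disc4 + conj w3 * disc3).re := by
  rw [C232S_eq_C232D_add (admissible_thetaIota w2 w3 w4), C232D_thetaIota, discS_thetaIota]

/-! ### Interval atoms -/

/- Keep the interval primitives opaque to the elaborator's unifier (cf. `Section8Certificate`). -/
attribute [local irreducible] CB.add CB.sub CB.mul CB.neg CB.conj CB.mulFI CB.mulI CB.mulInt
  CB.ofFI CB.ofInt CB.normSqFI CB.expI FI.add FI.sub FI.mul FI.neg FI.mulInt FI.divNat FI.divPos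
  FI.ofRat FI.ofInt FI.pi qCB piMul expIpi overPiFI piISq mulPiFI scaleRatFI recipFI
  recipMulPiFI expIpiFI

/-- `3/2 ∈ [3/2]`. [cite: Moore1966, Theorem 3.1] -/
theorem mem_k32 : FI.mem ((3 : ℝ) / 2) (FI.ofFrac 3 2) := by
  simpa using FI.mem_ofFrac 3 (q := 2) (by norm_num)
/-- `5/2 ∈ [5/2]`. [cite: Moore1966, Theorem 3.1] -/
theorem mem_k52 : FI.mem ((5 : ℝ) / 2) (FI.ofFrac 5 2) := by
  simpa using FI.mem_ofFrac 5 (q := 2) (by norm_num)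
/-- `L₇ = 0.504 + 0.5 − 1 ∈ [1/250]`. [cite: Zhang2022LandauSiegel, §12 (12.13)] -/
theorem mem_L7 : FI.mem ((0.504 : ℝ) + 0.5 - 1) (FI.ofFrac 1 250) := by
  have h := FI.mem_ofFrac 1 (q := 250) (by norm_num)
  norm_num at h ⊢; exact h
/-- `L₆ = 0.504 + 0.498 − 1 ∈ [1/500]`. [cite: Zhang2022LandauSiegel, §12 (12.13)] -/
theorem mem_L6 : FI.mem ((0.504 : ℝ) + 0.498 - 1) (FI.ofFrac 1 500) := by
  have h := FI.mem_ofFrac 1 (q := 500) (by norm_num)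
  norm_num at h ⊢; exact h
/-- frequency `5/2 − 3/2 ∈ [1]`. [cite: Moore1966, Theorem 3.1] -/
theorem mem_m1 : FI.mem ((5 : ℝ) / 2 - (3 : ℝ) / 2) (FI.ofInt 1) := by
  have h := FI.mem_ofInt 1
  norm_num at h ⊢; exact h
/-- frequency `0 − 3/2 ∈ [−3/2]`. [cite: Moore1966, Theorem 3.1] -/
theorem mem_m32neg : FI.mem ((0 : ℝ) - (3 : ℝ) / 2) (FI.ofFrac (-3) 2) := by
  have h := FI.mem_ofFrac (-3) (q := 2) (by norm_num)
  norm_num at h ⊢; exact h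
/-- prefactor `1/(0.504·0.5) = 250/63`. [cite: Moore1966, Theorem 3.1] -/
theorem mem_pref12 : FI.mem (1 / ((0.504 : ℝ) * 0.5)) (FI.ofFrac 250 63) := by
  have h := FI.mem_ofFrac 250 (q := 63) (by norm_num)
  norm_num at h ⊢; exact h
/-- prefactor `1/(0.504·0.498) = 62500/15687`. [cite: Moore1966, Theorem 3.1] -/
theorem mem_pref13 : FI.mem (1 / ((0.504 : ℝ) * 0.498)) (FI.ofFrac 62500 15687) := by
  have h := FI.mem_ofFrac 62500 (q := 15687) (by norm_num)
  norm_num at h ⊢; exact h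
/-- `24 ∈ CB.ofInt 24`. [cite: Moore1966, Theorem 3.1] -/
theorem mem_c24 : CB.mem (24 : ℂ) (CB.ofInt 24) := by simpa using CB.mem_ofInt 24

/-- `e^{kπiL}` in the `expIpiFI` form. [cite: Moore1966, Theorem 3.1] -/
theorem mem_cexp_kL {k l : ℝ} {K L : FI} (hk : FI.mem k K) (hl : FI.mem l L)
    (h : expIpiFIOK (K.mul L) = true) :
    CB.mem (cexp ((k : ℂ) * π * I * (l : ℂ))) (expIpiFI (K.mul L)) := by
  have h1 := mem_expIpiFI h (FI.mem_mul hk hl)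
  have e : cexp ((k : ℂ) * π * I * (l : ℂ)) = cexp ((((k * l * π : ℝ)) : ℂ) * I) := by
    congr 1; push_cast; ring
  rw [e]; exact h1

/-- `1/(π·5/2)² = ((2/5)/π)²` as a real cast. [folklore] -/
private theorem inv_pi_k52_sq : (1 / ((π : ℂ) * (((5 : ℝ) / 2 : ℝ) : ℂ)) ^ 2) = (((overPi (2/5) * overPi (2/5) : ℝ)) : ℂ) := by
  unfold overPi
  have hπ : (π : ℂ) ≠ 0 := by exact_mod_cast Real.pi_ne_zero
  push_cast
  field_simp
/-- `i/(π·5/2) = ((2/5)/π)·i`. [folklore] -/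
private theorem I_div_pi_k52 : (I / ((π : ℂ) * (((5 : ℝ) / 2 : ℝ) : ℂ))) = ((overPi (2/5) : ℝ) : ℂ) * I := by
  unfold overPi
  have hπ : (π : ℂ) ≠ 0 := by exact_mod_cast Real.pi_ne_zero
  push_cast
  field_simp
/-- `1/(π·3/2)² = ((2/3)/π)²` as a real cast. [folklore] -/
private theorem inv_pi_k32_sq : (1 / ((π : ℂ) * (((3 : ℝ) / 2 : ℝ) : ℂ)) ^ 2) = (((overPi (2/3) * overPi (2/3) : ℝ)) : ℂ) := by
  unfold overPi
  have hπ : (π : ℂ) ≠ 0 := by exact_mod_cast Real.pi_ne_zero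
  push_cast
  field_simp
/-- `i/(π·3/2) = ((2/3)/π)·i`. [folklore] -/
private theorem I_div_pi_k32 : (I / ((π : ℂ) * (((3 : ℝ) / 2 : ℝ) : ℂ))) = ((overPi (2/3) : ℝ) : ℂ) * I := by
  unfold overPi
  have hπ : (π : ℂ) ≠ 0 := by exact_mod_cast Real.pi_ne_zero
  push_cast
  field_simp

/-- `1/(π·5/2)² ∈ …` [cite: Moore1966, Theorem 3.1] -/
theorem mem_ck52sq : CB.mem (1 / ((π : ℂ) * (((5 : ℝ) / 2 : ℝ) : ℂ)) ^ 2)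
    (CB.ofFI ((overPiFI (2/5)).mul (overPiFI (2/5)))) := by
  have hf : overPiOK (2/5) = true := by decide +kernel
  have hu := mem_overPiFI hf
  rw [inv_pi_k52_sq]
  exact CB.mem_ofFI (FI.mem_mul hu hu)
/-- `i/(π·5/2) ∈ …` [cite: Moore1966, Theorem 3.1] -/
theorem mem_ck52 : CB.mem (I / ((π : ℂ) * (((5 : ℝ) / 2 : ℝ) : ℂ)))
    ((CB.ofFI (overPiFI (2/5))).mulI) := by
  have hf : overPiOK (2/5) = true := by decide +kernel
  have hu := mem_overPiFI hf
  rw [I_div_pi_k52]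
  exact CB.mem_mulI (CB.mem_ofFI hu)
/-- `1/(π·3/2)² ∈ …` [cite: Moore1966, Theorem 3.1] -/
theorem mem_ck32sq : CB.mem (1 / ((π : ℂ) * (((3 : ℝ) / 2 : ℝ) : ℂ)) ^ 2)
    (CB.ofFI ((overPiFI (2/3)).mul (overPiFI (2/3)))) := by
  have hf : overPiOK (2/3) = true := by decide +kernel
  have hu := mem_overPiFI hf
  rw [inv_pi_k32_sq]
  exact CB.mem_ofFI (FI.mem_mul hu hu)
/-- `i/(π·3/2) ∈ …` [cite: Moore1966, Theorem 3.1] -/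
theorem mem_ck32 : CB.mem (I / ((π : ℂ) * (((3 : ℝ) / 2 : ℝ) : ℂ)))
    ((CB.ofFI (overPiFI (2/3))).mulI) := by
  have hf : overPiOK (2/3) = true := by decide +kernel
  have hu := mem_overPiFI hf
  rw [I_div_pi_k32]
  exact CB.mem_mulI (CB.mem_ofFI hu)

/-! ### Boxes of the window data -/

/-- `k_a = 3/2` [folklore] -/ @[irreducible] def k32FI : FI := FI.ofFrac 3 2
/-- `k_b = 5/2` (window `b = 2`) [folklore] -/ @[irreducible] def k52FI : FI := FI.ofFrac 5 2
/-- `L₇ = 1/250` [folklore] -/ @[irreducible] def L7FI : FI := FI.ofFrac 1 250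
/-- `L₆ = 1/500` [folklore] -/ @[irreducible] def L6FI : FI := FI.ofFrac 1 500
/-- `m = 1` [folklore] -/ @[irreducible] def m1FI : FI := FI.ofInt 1
/-- `m = −3/2` (the `J₅` tail piece) [folklore] -/ @[irreducible] def m32negFI : FI := FI.ofFrac (-3) 2
/-- `iπk_a` [folklore] -/ @[irreducible] def ik32B : CB := ((CB.ofFI k32FI).mul (CB.ofFI FI.pi)).mulI
/-- `iπk_b`, `k_b = 5/2` [folklore] -/ @[irreducible] def ik52B : CB := ((CB.ofFI k52FI).mul (CB.ofFI FI.pi)).mulI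
/-- `e^{iπk_aL₇}` [folklore] -/ @[irreducible] def ex7B : CB := expIpiFI (k32FI.mul L7FI)
/-- `e^{iπk_aL₆}` [folklore] -/ @[irreducible] def ex6B : CB := expIpiFI (k32FI.mul L6FI)
/-- `1/(ν₁ν₂)` [folklore] -/ @[irreducible] def pref12B : CB := CB.ofFI (FI.ofFrac 250 63)
/-- `1/(ν₁ν₃)` [folklore] -/ @[irreducible] def pref13B : CB := CB.ofFI (FI.ofFrac 62500 15687)
/-- `1 + iπk_aL₇` [folklore] -/ @[irreducible] def u7B : CB := (CB.ofInt 1).add (ik32B.mul (CB.ofFI L7FI))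
/-- `1 + iπk_aL₆` [folklore] -/ @[irreducible] def u6B : CB := (CB.ofInt 1).add (ik32B.mul (CB.ofFI L6FI))
/-- `1/(πk_b)²`, `k_b = 5/2` [folklore] -/ @[irreducible] def ck52sqB : CB := CB.ofFI ((overPiFI (2/5)).mul (overPiFI (2/5)))
/-- `i/(πk_b)`, `k_b = 5/2` [folklore] -/ @[irreducible] def ck52B : CB := (CB.ofFI (overPiFI (2/5))).mulI
/-- `1/(πk_b)²`, `k_b = 3/2` [folklore] -/ @[irreducible] def ck32sqB : CB := CB.ofFI ((overPiFI (2/3)).mul (overPiFI (2/3)))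
/-- `i/(πk_b)`, `k_b = 3/2` [folklore] -/ @[irreducible] def ck32B : CB := (CB.ofFI (overPiFI (2/3))).mulI

/-- box of `J₁` (window `b = 2`) [folklore] -/
@[irreducible] def J1w12B : CB := pref12B.mul (ex7B.mul
  (expQuadIntBR u7B ((u7B.mul ik52B).sub ik32B) ((ik32B.neg).mul ik52B) m1FI L7FI))
/-- box of `J₂` (window `b = 2`) [folklore] -/
@[irreducible] def J2w12B : CB := pref12B.mul (ex7B.mul
  (expQuadIntBR (CB.ofInt 0) (CB.ofFI L7FI) (CB.ofInt 1).neg m1FI L7FI))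
/-- box of `J₃` (window `b = 2`) [folklore] -/
@[irreducible] def J3w12B : CB := (pref12B.neg).mul (ex7B.mul
  (expQuadIntBR (CB.ofInt 0) u7B (ik32B.neg) m1FI L7FI))
/-- box of `J₄` (window `b = 2`) [folklore] -/
@[irreducible] def J4w12B : CB := (pref12B.neg).mul (ex7B.mul
  (expQuadIntBR (CB.ofFI L7FI) (((CB.ofFI L7FI).mul ik52B).sub (CB.ofInt 1)) (ik52B.neg) m1FI L7FI))
/-- box of `J₅` (window `b = 2`) [folklore] -/
@[irreducible] def J5w12B : CB := pref12B.mul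
  ((ex7B.mul (expQuadIntBR ((CB.ofFI L7FI).mul ck52sqB) ((ck52sqB.neg).sub ((CB.ofFI L7FI).mul ck52B)) ck52B m1FI L7FI)).sub
    (ck52sqB.mul (ex7B.mul (expQuadIntBR (CB.ofFI L7FI) (CB.ofInt 1).neg (CB.ofInt 0) m32negFI L7FI))))

/-- box of `J₁` (window `b = 3`) [folklore] -/
@[irreducible] def J1w13B : CB := pref13B.mul (ex6B.mul
  (polyIntB u6B ((u6B.mul ik32B).sub ik32B) ((ik32B.neg).mul ik32B) L6FI))
/-- box of `J₂` (window `b = 3`) [folklore] -/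
@[irreducible] def J2w13B : CB := pref13B.mul (ex6B.mul
  (polyIntB (CB.ofInt 0) (CB.ofFI L6FI) (CB.ofInt 1).neg L6FI))
/-- box of `J₃` (window `b = 3`) [folklore] -/
@[irreducible] def J3w13B : CB := (pref13B.neg).mul (ex6B.mul
  (polyIntB (CB.ofInt 0) u6B (ik32B.neg) L6FI))
/-- box of `J₄` (window `b = 3`) [folklore] -/
@[irreducible] def J4w13B : CB := (pref13B.neg).mul (ex6B.mul
  (polyIntB (CB.ofFI L6FI) (((CB.ofFI L6FI).mul ik32B).sub (CB.ofInt 1)) (ik32B.neg) L6FI))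
/-- box of `J₅` (window `b = 3`) [folklore] -/
@[irreducible] def J5w13B : CB := pref13B.mul
  ((ex6B.mul (polyIntB ((CB.ofFI L6FI).mul ck32sqB) ((ck32sqB.neg).sub ((CB.ofFI L6FI).mul ck32B)) ck32B L6FI)).sub
    (ck32sqB.mul (ex6B.mul (expQuadIntBR (CB.ofFI L6FI) (CB.ofInt 1).neg (CB.ofInt 0) m32negFI L6FI))))

/-- validity flags of the interval primitives used (reciprocals, exponentials). [cite: Moore1966, Theorem 3.1] -/
theorem flags_ok : recipMulPiOK m1FI = true ∧ recipMulPiOK m32negFI = true ∧ expIpiFIOK (m1FI.mul L7FI) = true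
    ∧ expIpiFIOK (m32negFI.mul L7FI) = true ∧ expIpiFIOK (m32negFI.mul L6FI) = true ∧ expIpiFIOK (k32FI.mul L7FI) = true
    ∧ expIpiFIOK (k32FI.mul L6FI) = true := by
  unfold m1FI m32negFI L7FI L6FI k32FI; decide +kernel

section atoms
/-! Shared atom enclosures (window data). -/

/-- atom enclosure (window data) [folklore] -/
private theorem hk32 : FI.mem ((3 : ℝ) / 2) k32FI := by unfold k32FI; exact mem_k32
/-- atom enclosure (window data) [folklore] -/
private theorem hk52 : FI.mem ((5 : ℝ) / 2) k52FI := by unfold k52FI; exact mem_k52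
/-- atom enclosure (window data) [folklore] -/
private theorem hL7 : FI.mem ((0.504 : ℝ) + 0.5 - 1) L7FI := by unfold L7FI; exact mem_L7
/-- atom enclosure (window data) [folklore] -/
private theorem hL6 : FI.mem ((0.504 : ℝ) + 0.498 - 1) L6FI := by unfold L6FI; exact mem_L6
/-- atom enclosure (window data) [folklore] -/
private theorem hm1 : FI.mem ((5 : ℝ) / 2 - (3 : ℝ) / 2) m1FI := by unfold m1FI; exact mem_m1
/-- atom enclosure (window data) [folklore] -/
private theorem hm32neg : FI.mem ((0 : ℝ) - (3 : ℝ) / 2) m32negFI := by unfold m32negFI; exact mem_m32neg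
/-- atom enclosure (window data) [folklore] -/
private theorem hik32 : CB.mem ((((3 : ℝ) / 2 : ℝ) : ℂ) * π * I) ik32B := by
  unfold ik32B; exact CB.mem_mulI (CB.mem_mul (CB.mem_ofFI hk32) mem_piCB)
/-- atom enclosure (window data) [folklore] -/
private theorem hik52 : CB.mem ((((5 : ℝ) / 2 : ℝ) : ℂ) * π * I) ik52B := by
  unfold ik52B; exact CB.mem_mulI (CB.mem_mul (CB.mem_ofFI hk52) mem_piCB)
/-- atom enclosure (window data) [folklore] -/
private theorem hex7 : CB.mem (cexp ((((3 : ℝ) / 2 : ℝ) : ℂ) * π * I * (((0.504 : ℝ) + 0.5 - 1 : ℝ) : ℂ))) ex7B := by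
  unfold ex7B; exact mem_cexp_kL hk32 hL7 flags_ok.2.2.2.2.2.1
/-- atom enclosure (window data) [folklore] -/
private theorem hex6 : CB.mem (cexp ((((3 : ℝ) / 2 : ℝ) : ℂ) * π * I * (((0.504 : ℝ) + 0.498 - 1 : ℝ) : ℂ))) ex6B := by
  unfold ex6B; exact mem_cexp_kL hk32 hL6 flags_ok.2.2.2.2.2.2
/-- atom enclosure (window data) [folklore] -/
private theorem hpref12 : CB.mem (((1 / ((0.504 : ℝ) * 0.5) : ℝ)) : ℂ) pref12B := by
  unfold pref12B; exact CB.mem_ofFI mem_pref12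
/-- atom enclosure (window data) [folklore] -/
private theorem hpref13 : CB.mem (((1 / ((0.504 : ℝ) * 0.498) : ℝ)) : ℂ) pref13B := by
  unfold pref13B; exact CB.mem_ofFI mem_pref13
/-- atom enclosure (window data) [folklore] -/
private theorem hu7 : CB.mem (1 + (((3 : ℝ) / 2 : ℝ) : ℂ) * π * I * (((0.504 : ℝ) + 0.5 - 1 : ℝ) : ℂ)) u7B := by
  unfold u7B; exact CB.mem_add mem_oneCB (CB.mem_mul hik32 (CB.mem_ofFI hL7))
/-- atom enclosure (window data) [folklore] -/
private theorem hu6 : CB.mem (1 + (((3 : ℝ) / 2 : ℝ) : ℂ) * π * I * (((0.504 : ℝ) + 0.498 - 1 : ℝ) : ℂ)) u6B := by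
  unfold u6B; exact CB.mem_add mem_oneCB (CB.mem_mul hik32 (CB.mem_ofFI hL6))
/-- atom enclosure (window data) [folklore] -/
private theorem hck52sq : CB.mem (1 / ((π : ℂ) * (((5 : ℝ) / 2 : ℝ) : ℂ)) ^ 2) ck52sqB := by unfold ck52sqB; exact mem_ck52sq
/-- atom enclosure (window data) [folklore] -/
private theorem hck52 : CB.mem (I / ((π : ℂ) * (((5 : ℝ) / 2 : ℝ) : ℂ))) ck52B := by unfold ck52B; exact mem_ck52
/-- atom enclosure (window data) [folklore] -/
private theorem hck32sq : CB.mem (1 / ((π : ℂ) * (((3 : ℝ) / 2 : ℝ) : ℂ)) ^ 2) ck32sqB := by unfold ck32sqB; exact mem_ck32sq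
/-- atom enclosure (window data) [folklore] -/
private theorem hck32 : CB.mem (I / ((π : ℂ) * (((3 : ℝ) / 2 : ℝ) : ℂ))) ck32B := by unfold ck32B; exact mem_ck32

/-- `J₁(0.504,3/2;0.5,5/2) ∈ J1w12B`. [cite: Zhang2022LandauSiegel, §12 (12.12)–(12.14)] -/
theorem mem_J1w12 : CB.mem (J1w 0.504 (3/2) 0.5 (5/2)) J1w12B := by
  have hR := flags_ok.1; have hE := flags_ok.2.2.1
  rw [J1w_closed_of_ne (νa := 0.504) (ka := 3/2) (νb := 0.5) (kb := 5/2) (by norm_num)]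
  unfold J1w12B
  apply_rules [CB.mem_mul, CB.mem_sub, CB.mem_neg, mem_expQuadIntBR, hpref12, hex7, hu7, hik32, hik52,
    hm1, hL7]

/-- `J₂(0.504,3/2;0.5,5/2) ∈ J2w12B`. [cite: Zhang2022LandauSiegel, §12 (12.12)–(12.14)] -/
theorem mem_J2w12 : CB.mem (J2w 0.504 (3/2) 0.5 (5/2)) J2w12B := by
  have hR := flags_ok.1; have hE := flags_ok.2.2.1
  rw [J2w_closed_of_ne (νa := 0.504) (ka := 3/2) (νb := 0.5) (kb := 5/2) (by norm_num) (by norm_num)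
    (by norm_num)]
  unfold J2w12B
  apply_rules [CB.mem_mul, CB.mem_neg, mem_expQuadIntBR, hpref12, hex7, CB.mem_ofFI, hL7, hm1,
    mem_zeroCB, mem_oneCB]

/-- `J₃(0.504,3/2;0.5,5/2) ∈ J3w12B`. [cite: Zhang2022LandauSiegel, §12 (12.12)–(12.14)] -/
theorem mem_J3w12 : CB.mem (J3w 0.504 (3/2) 0.5 (5/2)) J3w12B := by
  have hR := flags_ok.1; have hE := flags_ok.2.2.1
  rw [J3w_closed_of_ne (νa := 0.504) (ka := 3/2) (νb := 0.5) (kb := 5/2) (by norm_num) (by norm_num)]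
  unfold J3w12B
  apply_rules [CB.mem_mul, CB.mem_neg, mem_expQuadIntBR, hpref12, hex7, hu7, hik32, hL7, hm1, mem_zeroCB]

/-- `J₄(0.504,3/2;0.5,5/2) ∈ J4w12B`. [cite: Zhang2022LandauSiegel, §12 (12.12)–(12.14)] -/
theorem mem_J4w12 : CB.mem (J4w 0.504 (3/2) 0.5 (5/2)) J4w12B := by
  have hR := flags_ok.1; have hE := flags_ok.2.2.1
  rw [J4w_closed_of_ne (νa := 0.504) (ka := 3/2) (νb := 0.5) (kb := 5/2) (by norm_num) (by norm_num)]
  unfold J4w12B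
  apply_rules [CB.mem_mul, CB.mem_sub, CB.mem_neg, mem_expQuadIntBR, hpref12, hex7, hik52, CB.mem_ofFI,
    hL7, hm1, mem_oneCB]

/-- `J₅(0.504,3/2;0.5,5/2) ∈ J5w12B`. [cite: Zhang2022LandauSiegel, §12 (12.12)–(12.14)] -/
theorem mem_J5w12 : CB.mem (J5w 0.504 (3/2) 0.5 (5/2)) J5w12B := by
  have hR := flags_ok.1; have hR0 := flags_ok.2.1; have hE := flags_ok.2.2.1; have hE0 := flags_ok.2.2.2.1
  rw [J5w_closed_of_ne (νa := 0.504) (ka := 3/2) (νb := 0.5) (kb := 5/2) (by norm_num) (by norm_num)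
    (by norm_num)]
  unfold J5w12B
  apply_rules [CB.mem_mul, CB.mem_sub, CB.mem_neg, mem_expQuadIntBR, hpref12, hex7, hck52sq, hck52,
    CB.mem_ofFI, hL7, hm1, hm32neg, mem_oneCB, mem_zeroCB]

/-- `J₁(0.504,3/2;0.498,3/2) ∈ J1w13B`. [cite: Zhang2022LandauSiegel, §12 (12.12)–(12.14)] -/
theorem mem_J1w13 : CB.mem (J1w 0.504 (3/2) 0.498 (3/2)) J1w13B := by
  rw [J1w_closed_of_eq (νa := 0.504) (ka := 3/2) (νb := 0.498) (kb := 3/2) rfl]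
  unfold J1w13B
  apply_rules [CB.mem_mul, CB.mem_sub, CB.mem_neg, mem_polyIntB_real, hpref13, hex6, hu6, hik32, hL6]

/-- `J₂(0.504,3/2;0.498,3/2) ∈ J2w13B`. [cite: Zhang2022LandauSiegel, §12 (12.12)–(12.14)] -/
theorem mem_J2w13 : CB.mem (J2w 0.504 (3/2) 0.498 (3/2)) J2w13B := by
  rw [J2w_closed_of_eq (νa := 0.504) (ka := 3/2) (νb := 0.498) (kb := 3/2) (by norm_num) (by norm_num) rfl]
  unfold J2w13B
  apply_rules [CB.mem_mul, CB.mem_neg, mem_polyIntB_real, hpref13, hex6, CB.mem_ofFI, hL6, mem_zeroCB,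
    mem_oneCB]

/-- `J₃(0.504,3/2;0.498,3/2) ∈ J3w13B`. [cite: Zhang2022LandauSiegel, §12 (12.12)–(12.14)] -/
theorem mem_J3w13 : CB.mem (J3w 0.504 (3/2) 0.498 (3/2)) J3w13B := by
  rw [J3w_closed_of_eq (νa := 0.504) (ka := 3/2) (νb := 0.498) (kb := 3/2) (by norm_num) rfl]
  unfold J3w13B
  apply_rules [CB.mem_mul, CB.mem_neg, mem_polyIntB_real, hpref13, hex6, hu6, hik32, hL6, mem_zeroCB]

/-- `J₄(0.504,3/2;0.498,3/2) ∈ J4w13B`. [cite: Zhang2022LandauSiegel, §12 (12.12)–(12.14)] -/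
theorem mem_J4w13 : CB.mem (J4w 0.504 (3/2) 0.498 (3/2)) J4w13B := by
  rw [J4w_closed_of_eq (νa := 0.504) (ka := 3/2) (νb := 0.498) (kb := 3/2) (by norm_num) rfl]
  unfold J4w13B
  apply_rules [CB.mem_mul, CB.mem_sub, CB.mem_neg, mem_polyIntB_real, hpref13, hex6, hik32, CB.mem_ofFI,
    hL6, mem_oneCB]

/-- `J₅(0.504,3/2;0.498,3/2) ∈ J5w13B`. [cite: Zhang2022LandauSiegel, §12 (12.12)–(12.14)] -/
theorem mem_J5w13 : CB.mem (J5w 0.504 (3/2) 0.498 (3/2)) J5w13B := by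
  have hR0 := flags_ok.2.1; have hE0 := flags_ok.2.2.2.2.1
  rw [J5w_closed_of_eq (νa := 0.504) (ka := 3/2) (νb := 0.498) (kb := 3/2) (by norm_num) rfl
    (by norm_num)]
  unfold J5w13B
  apply_rules [CB.mem_mul, CB.mem_sub, CB.mem_neg, mem_polyIntB_real, mem_expQuadIntBR, hpref13, hex6,
    hck32sq, hck32, CB.mem_ofFI, hL6, hm32neg, mem_oneCB, mem_zeroCB]

end atoms

end Repair

end Literature.NumberTheory.LFunctions.Zhang2022
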